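import Summits.BirchSwinnertonDyer.BirchSwinnertonDyer.Theorems.PrintCFramBottomClassIndexLawFiveLeKrizLiBindersTwistedBlock
import Summits.BirchSwinnertonDyer.BirchSwinnertonDyer.Theorems.PrintCFramBottomClassIndexLawFiveLeKrizLi4EngineEven
import Summits.BirchSwinnertonDyer.BirchSwinnertonDyer.Theorems.PrintCFramBottomClassIndexLawFiveLeKrizLi4Cert67and43
import HarnessLib

/-!
# Crux `PrintCFram.BottomClassIndexLawFiveLe` (stmt-BirchSwinnertonDyer-20372), line `eisenstein-resource-bdp-line` (registry v10/v11):
# the TWISTED window classes at `p = 43, 67` with `|d_K|` odd squarefree (prime or not); here the twisting discriminant is EVEN-TYPE (`d ≡ 2, 3 (mod 4)`, class character of conductor `4d`; engine `krizLi_characterBernoulliBlock_twist_even_sqfree`, this seat) are ON THE KRIZ–LI LOCUS BY NAME —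
# `exists_krizLiCharacterBlock_<label>` for `118336a1`, `266256bp1`, `287296h1`
# (cell `bsd-print-cfram`, width seat `bsd-line-cfram-p1-w5` g0; THEOREMS ONLY, `--supports` 20372; BSD is not proved by any of this)

HONEST FRAMING. Nothing here proves BSD or closes a stub of the skeleton. The ON-LOCUS (Kriz–Li) branch of the registered composition
consumes, per member `W` and Heegner field `K''`, the character ∧ `ε_K` ∧ Bernoulli block `(f ψ ω εK ∣ hψ hω hss h1 h1' h3 hεK h4)`.
w3 g2 built it at the untwisted anchors (`…KrizLiBindersAnchor11/19/43/67`), w3 g3 the twisted ENGINE `krizLi_characterBernoulliBlock_twist_odd`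
and the first twisted instance `exists_krizLiCharacterBlock_3025a` (`…KrizLiBindersTwistedBlock`), and this seat the 66 Bernoulli-unit
certificates of all 33 twisted window classes at `p ≥ 11` (`…KrizLi4Cert*`). THIS FILE assembles, for the classes listed below (`|d_K|` odd squarefree (prime or not); here the twisting discriminant is EVEN-TYPE (`d ≡ 2, 3 (mod 4)`, class character of conductor `4d`; engine `krizLi_characterBernoulliBlock_twist_even_sqfree`, this seat)), the per-class block exactly as w3 g3 did for 3025a (through the even-type engine `…KrizLi4EngineEven` (class character from `KrizLiBinders.exists_kroneckerFourPadic`)):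
`χ_d` from `KrizLiBinders.exists_jacobiCharPadic`, `ε_K` from `KrizLiBinders.exists_isKroneckerCharacterOf_of_discr`, `ω` from
`exists_isTeichmullerCharacter`, the base curve `cm43`'s trace form and good reduction (`EisensteinTraceForm.lFunction_cm43_mod`,
`hasGoodReductionAtPrime_cm43`), and the two certificates `KrizLi4Cert.norm_generalizedBernoulli_theta1/2_<label>` (the `K''`-factor through
`J(j | m·q) = J(j | m)·J(j | q)`). Classes (label: `d`, `d_K`): `118336a1` (`2`, `-7`); `266256bp1` (`3`, `-71`); `287296h1` (`2`, `-7`). Remaining tiers (composite `|d_K|`; even-type `d`) need engine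
variants and are not in this file. What this does NOT give: Heegner data over `K''`, `L(W^{(d_K)},1) ≠ 0`, Stub H, anything off the locus.
beyond-print theorem: NO. References: [KrizLi2019] Thm. 1.20 (pp. 7–8), Rem. 1.21, §1.5, §2, §7.1; [Washington1997] §5.1, Thm. 4.2;
[Cox2013] §1.C Lemma 1.14; Cremona labels as in w2 g4's census `Lines/eisenstein-resource-bdp-line-w2g4-kl4-census.md` §3.
-/

set_option autoImplicit false
set_option linter.dupNamespace false

noncomputable section

open scoped Classical

namespace Summit.BirchSwinnertonDyer.BirchSwinnertonDyer.Theorems.PrintCFram.KrizLiBindersTwisted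

open scoped NumberTheorySymbols
open WeierstrassCurve IsDedekindDomain NumberField DirichletCharacter Literature.NumberTheory.LFunctions
  Literature.NumberTheory.EllipticCurves Literature.NumberTheory.EllipticCurves.ModularForms
  Literature.NumberTheory.EllipticCurves.Rank1Residual Literature.NumberTheory.EllipticCurves.KrizLi2019
  Summit.BirchSwinnertonDyer.Rank1Residual Summit.BirchSwinnertonDyer.Rank1Residual.X12.O11
  Summit.BirchSwinnertonDyer.BirchSwinnertonDyer.Theorems.PrintCFram

/-! ## §1 `118336a1` = `A(43)^{(2)}`, `ψ = χ_{2}·ω^{11}`, `K'' = ℚ(√-7)` -/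

/-- **`118336a1` = `A(43)^{(2)}` (even-type twisting discriminant, class character of conductor `8`) lies ON the Kriz–Li locus BY NAME
over every quadratic `K''` of discriminant `-7`**: for every `W` `ℚ`-isogenous to a curve `ℚ`-isomorphic to `cm43.quadraticTwist 2`,
`∃ f ψ ω εK`, `ψ.IsPrimitive ∧ IsTeichmullerCharacter ω ∧ hss ∧ (1) ∧ (3) ∧ IsKroneckerCharacterOf K'' εK ∧ (4) ∧ ψ.Odd` (`ψ = χ_{8}·ω^{11}`,
`χ_{8}(a) = [a odd]·J(2 | a)`) — the even-type engine `krizLi_characterBernoulliBlock_twist_even_sqfree` (this seat) fed with the certificates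
`KrizLi4Cert.norm_generalizedBernoulli_theta1/2_118336a1`. What it does NOT give: Heegner data over `K''`, `L(W^{(-7)},1) ≠ 0`, Stub H.
[cite: KrizLi2019, Thm. 1.20 (pp. 7–8), Rem. 1.21, §2 (p. 12)] [cite: Cox2013, §1.C Lemma 1.14] -/
theorem exists_krizLiCharacterBlock_118336a1 [Fact (Nat.Prime 43)] (W W₁ : WeierstrassCurve ℚ) [W.IsElliptic] [W₁.IsElliptic]
    (hiso : IsIsogenous W W₁) (hW₁ : ∃ C : VariableChange ℚ, C • W₁ = cm43.quadraticTwist ((2 : ℤ) : ℚ))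
    (K : Type) [Field K] [NumberField K] (hK2 : Module.finrank ℚ K = 2)
    (hdK : NumberField.discr K = -7) [NeZero (NumberField.discr K).natAbs] :
    ∃ (f : ℕ) (_ : NeZero f) (ψ : DirichletCharacter ℚ_[43] f) (ω : DirichletCharacter ℚ_[43] 43)
      (εK : DirichletCharacter ℚ_[43] (NumberField.discr K).natAbs),
      ψ.IsPrimitive ∧ IsTeichmullerCharacter ω ∧
      (∀ ℓ : ℕ, ℓ.Prime → ¬ (ℓ ∣ 43 * W.conductorNorm ℤ) →
        ‖((W.LFunction ℓ : ℤ) : ℚ_[43]) - (ψ (ℓ : ZMod f) + ψ⁻¹ (ℓ : ZMod f) * ω (ℓ : ZMod 43))‖ < 1) ∧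
      (ψ ((43 : ℕ) : ZMod f) ≠ 1 ∧ primVal (invMulOmega ψ ω) 43 ≠ 1) ∧
      (∀ ℓ : ℕ, (hℓ : ℓ.Prime) → ℓ ≠ 43 →
        (haveI := Fact.mk hℓ; ¬ W.HasGoodReductionAtPrime ℓ ∧ ¬ W.HasMultiplicativeReductionAtPrime ℓ) →
        ψ (ℓ : ZMod f) ≠ 1 ∧ primVal (invMulOmega ψ ω) ℓ ≠ 1) ∧
      IsKroneckerCharacterOf K εK ∧
      ¬ (‖bernoulliOnePrim (bernoulliCharOne ψ εK) * bernoulliOnePrim (bernoulliCharTwo ψ εK ω)‖ ≤ ((43 : ℕ) : ℝ)⁻¹) ∧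
      ψ.Odd := by
  haveI : NeZero (7 : ℕ) := ⟨by norm_num⟩
  obtain ⟨ω, hω⟩ := exists_isTeichmullerCharacter (p := 43)
  obtain ⟨εK, hεK, hεKval⟩ := KrizLiBinders.exists_isKroneckerCharacterOf_of_discr (p := 43) hK2
    (Nat.Prime.prime (by norm_num : Nat.Prime 7)).squarefree (Or.inr ⟨hdK, by norm_num⟩)
  have hd : (NumberField.discr K).natAbs = 7 := by rw [hdK]; rfl
  haveI : NeZero (4 * ((2 : ℤ)).natAbs) := ⟨by decide⟩
  obtain ⟨χ, hχ⟩ := KrizLiBinders.exists_kroneckerFourPadic (p := 43) ((2 : ℤ)) (by norm_num) (k := 4 * ((2 : ℤ)).natAbs) rfl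
  have hpar : χ (-1) * (-1) ^ 11 = -1 := by
    have e : ((7 : ℕ) : ZMod (4 * ((2 : ℤ)).natAbs)) = -1 := by decide
    rw [← e, hχ 7]; norm_num
  obtain ⟨f, hf, ψ, hprim, hodd, hss, h1, h3, h4⟩ :=
    krizLi_characterBernoulliBlock_twist_even_sqfree (p := 43) (by norm_num) cm43 (k := 11) (by norm_num) (by norm_num)
      (fun r _ hr => EisensteinTraceForm.hasGoodReductionAtPrime_cm43 r hr)
      (fun ℓ _ hℓ => by simpa using EisensteinTraceForm.lFunction_cm43_mod ℓ hℓ) W W₁ hiso (e := 2) (by norm_num)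
      (by rw [← Int.squarefree_natAbs]; exact (Nat.Prime.prime (by norm_num : Nat.Prime 2)).squarefree) (by norm_num) hW₁ χ hχ hpar ω hω
      (q := 7) (by decide) (Nat.Prime.prime (by norm_num : Nat.Prime 7)).squarefree (by norm_num) (by decide) hd εK hεKval
      (fun θ₁ hθ₁ => KrizLi4Cert.norm_generalizedBernoulli_theta1_118336a1 ω hω θ₁ hθ₁)
      (fun θ₂ hθ₂ => KrizLi4Cert.norm_generalizedBernoulli_theta2_118336a1 ω hω θ₂ hθ₂)
  exact ⟨f, hf, ψ, ω, εK, hprim, hω, hss, h1, h3, hεK, by exact_mod_cast h4, hodd⟩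

/-! ## §2 `266256bp1` = `A(43)^{(3)}`, `ψ = χ_{3}·ω^{11}`, `K'' = ℚ(√-71)` -/

/-- **`266256bp1` = `A(43)^{(3)}` (even-type twisting discriminant, class character of conductor `12`) lies ON the Kriz–Li locus BY NAME
over every quadratic `K''` of discriminant `-71`**: for every `W` `ℚ`-isogenous to a curve `ℚ`-isomorphic to `cm43.quadraticTwist 3`,
`∃ f ψ ω εK`, `ψ.IsPrimitive ∧ IsTeichmullerCharacter ω ∧ hss ∧ (1) ∧ (3) ∧ IsKroneckerCharacterOf K'' εK ∧ (4) ∧ ψ.Odd` (`ψ = χ_{12}·ω^{11}`,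
`χ_{12}(a) = [a odd]·J(3 | a)`) — the even-type engine `krizLi_characterBernoulliBlock_twist_even_sqfree` (this seat) fed with the certificates
`KrizLi4Cert.norm_generalizedBernoulli_theta1/2_266256bp1`. What it does NOT give: Heegner data over `K''`, `L(W^{(-71)},1) ≠ 0`, Stub H.
[cite: KrizLi2019, Thm. 1.20 (pp. 7–8), Rem. 1.21, §2 (p. 12)] [cite: Cox2013, §1.C Lemma 1.14] -/
theorem exists_krizLiCharacterBlock_266256bp1 [Fact (Nat.Prime 43)] (W W₁ : WeierstrassCurve ℚ) [W.IsElliptic] [W₁.IsElliptic]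
    (hiso : IsIsogenous W W₁) (hW₁ : ∃ C : VariableChange ℚ, C • W₁ = cm43.quadraticTwist ((3 : ℤ) : ℚ))
    (K : Type) [Field K] [NumberField K] (hK2 : Module.finrank ℚ K = 2)
    (hdK : NumberField.discr K = -71) [NeZero (NumberField.discr K).natAbs] :
    ∃ (f : ℕ) (_ : NeZero f) (ψ : DirichletCharacter ℚ_[43] f) (ω : DirichletCharacter ℚ_[43] 43)
      (εK : DirichletCharacter ℚ_[43] (NumberField.discr K).natAbs),
      ψ.IsPrimitive ∧ IsTeichmullerCharacter ω ∧
      (∀ ℓ : ℕ, ℓ.Prime → ¬ (ℓ ∣ 43 * W.conductorNorm ℤ) →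
        ‖((W.LFunction ℓ : ℤ) : ℚ_[43]) - (ψ (ℓ : ZMod f) + ψ⁻¹ (ℓ : ZMod f) * ω (ℓ : ZMod 43))‖ < 1) ∧
      (ψ ((43 : ℕ) : ZMod f) ≠ 1 ∧ primVal (invMulOmega ψ ω) 43 ≠ 1) ∧
      (∀ ℓ : ℕ, (hℓ : ℓ.Prime) → ℓ ≠ 43 →
        (haveI := Fact.mk hℓ; ¬ W.HasGoodReductionAtPrime ℓ ∧ ¬ W.HasMultiplicativeReductionAtPrime ℓ) →
        ψ (ℓ : ZMod f) ≠ 1 ∧ primVal (invMulOmega ψ ω) ℓ ≠ 1) ∧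
      IsKroneckerCharacterOf K εK ∧
      ¬ (‖bernoulliOnePrim (bernoulliCharOne ψ εK) * bernoulliOnePrim (bernoulliCharTwo ψ εK ω)‖ ≤ ((43 : ℕ) : ℝ)⁻¹) ∧
      ψ.Odd := by
  haveI : NeZero (71 : ℕ) := ⟨by norm_num⟩
  obtain ⟨ω, hω⟩ := exists_isTeichmullerCharacter (p := 43)
  obtain ⟨εK, hεK, hεKval⟩ := KrizLiBinders.exists_isKroneckerCharacterOf_of_discr (p := 43) hK2
    (Nat.Prime.prime (by norm_num : Nat.Prime 71)).squarefree (Or.inr ⟨hdK, by norm_num⟩)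
  have hd : (NumberField.discr K).natAbs = 71 := by rw [hdK]; rfl
  haveI : NeZero (4 * ((3 : ℤ)).natAbs) := ⟨by decide⟩
  obtain ⟨χ, hχ⟩ := KrizLiBinders.exists_kroneckerFourPadic (p := 43) ((3 : ℤ)) (by norm_num) (k := 4 * ((3 : ℤ)).natAbs) rfl
  have hpar : χ (-1) * (-1) ^ 11 = -1 := by
    have e : ((11 : ℕ) : ZMod (4 * ((3 : ℤ)).natAbs)) = -1 := by decide
    rw [← e, hχ 11]; norm_num
  obtain ⟨f, hf, ψ, hprim, hodd, hss, h1, h3, h4⟩ :=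
    krizLi_characterBernoulliBlock_twist_even_sqfree (p := 43) (by norm_num) cm43 (k := 11) (by norm_num) (by norm_num)
      (fun r _ hr => EisensteinTraceForm.hasGoodReductionAtPrime_cm43 r hr)
      (fun ℓ _ hℓ => by simpa using EisensteinTraceForm.lFunction_cm43_mod ℓ hℓ) W W₁ hiso (e := 3) (by norm_num)
      (by rw [← Int.squarefree_natAbs]; exact (Nat.Prime.prime (by norm_num : Nat.Prime 3)).squarefree) (by norm_num) hW₁ χ hχ hpar ω hω
      (q := 71) (by decide) (Nat.Prime.prime (by norm_num : Nat.Prime 71)).squarefree (by norm_num) (by decide) hd εK hεKval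
      (fun θ₁ hθ₁ => KrizLi4Cert.norm_generalizedBernoulli_theta1_266256bp1 ω hω θ₁ hθ₁)
      (fun θ₂ hθ₂ => KrizLi4Cert.norm_generalizedBernoulli_theta2_266256bp1 ω hω θ₂ hθ₂)
  exact ⟨f, hf, ψ, ω, εK, hprim, hω, hss, h1, h3, hεK, by exact_mod_cast h4, hodd⟩

/-! ## §3 `287296h1` = `A(67)^{(2)}`, `ψ = χ_{2}·ω^{17}`, `K'' = ℚ(√-7)` -/

/-- **`287296h1` = `A(67)^{(2)}` (even-type twisting discriminant, class character of conductor `8`) lies ON the Kriz–Li locus BY NAME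
over every quadratic `K''` of discriminant `-7`**: for every `W` `ℚ`-isogenous to a curve `ℚ`-isomorphic to `cm67.quadraticTwist 2`,
`∃ f ψ ω εK`, `ψ.IsPrimitive ∧ IsTeichmullerCharacter ω ∧ hss ∧ (1) ∧ (3) ∧ IsKroneckerCharacterOf K'' εK ∧ (4) ∧ ψ.Odd` (`ψ = χ_{8}·ω^{17}`,
`χ_{8}(a) = [a odd]·J(2 | a)`) — the even-type engine `krizLi_characterBernoulliBlock_twist_even_sqfree` (this seat) fed with the certificates
`KrizLi4Cert.norm_generalizedBernoulli_theta1/2_287296h1`. What it does NOT give: Heegner data over `K''`, `L(W^{(-7)},1) ≠ 0`, Stub H.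
[cite: KrizLi2019, Thm. 1.20 (pp. 7–8), Rem. 1.21, §2 (p. 12)] [cite: Cox2013, §1.C Lemma 1.14] -/
theorem exists_krizLiCharacterBlock_287296h1 [Fact (Nat.Prime 67)] (W W₁ : WeierstrassCurve ℚ) [W.IsElliptic] [W₁.IsElliptic]
    (hiso : IsIsogenous W W₁) (hW₁ : ∃ C : VariableChange ℚ, C • W₁ = cm67.quadraticTwist ((2 : ℤ) : ℚ))
    (K : Type) [Field K] [NumberField K] (hK2 : Module.finrank ℚ K = 2)
    (hdK : NumberField.discr K = -7) [NeZero (NumberField.discr K).natAbs] :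
    ∃ (f : ℕ) (_ : NeZero f) (ψ : DirichletCharacter ℚ_[67] f) (ω : DirichletCharacter ℚ_[67] 67)
      (εK : DirichletCharacter ℚ_[67] (NumberField.discr K).natAbs),
      ψ.IsPrimitive ∧ IsTeichmullerCharacter ω ∧
      (∀ ℓ : ℕ, ℓ.Prime → ¬ (ℓ ∣ 67 * W.conductorNorm ℤ) →
        ‖((W.LFunction ℓ : ℤ) : ℚ_[67]) - (ψ (ℓ : ZMod f) + ψ⁻¹ (ℓ : ZMod f) * ω (ℓ : ZMod 67))‖ < 1) ∧
      (ψ ((67 : ℕ) : ZMod f) ≠ 1 ∧ primVal (invMulOmega ψ ω) 67 ≠ 1) ∧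
      (∀ ℓ : ℕ, (hℓ : ℓ.Prime) → ℓ ≠ 67 →
        (haveI := Fact.mk hℓ; ¬ W.HasGoodReductionAtPrime ℓ ∧ ¬ W.HasMultiplicativeReductionAtPrime ℓ) →
        ψ (ℓ : ZMod f) ≠ 1 ∧ primVal (invMulOmega ψ ω) ℓ ≠ 1) ∧
      IsKroneckerCharacterOf K εK ∧
      ¬ (‖bernoulliOnePrim (bernoulliCharOne ψ εK) * bernoulliOnePrim (bernoulliCharTwo ψ εK ω)‖ ≤ ((67 : ℕ) : ℝ)⁻¹) ∧
      ψ.Odd := by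
  haveI : NeZero (7 : ℕ) := ⟨by norm_num⟩
  obtain ⟨ω, hω⟩ := exists_isTeichmullerCharacter (p := 67)
  obtain ⟨εK, hεK, hεKval⟩ := KrizLiBinders.exists_isKroneckerCharacterOf_of_discr (p := 67) hK2
    (Nat.Prime.prime (by norm_num : Nat.Prime 7)).squarefree (Or.inr ⟨hdK, by norm_num⟩)
  have hd : (NumberField.discr K).natAbs = 7 := by rw [hdK]; rfl
  haveI : NeZero (4 * ((2 : ℤ)).natAbs) := ⟨by decide⟩
  obtain ⟨χ, hχ⟩ := KrizLiBinders.exists_kroneckerFourPadic (p := 67) ((2 : ℤ)) (by norm_num) (k := 4 * ((2 : ℤ)).natAbs) rfl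
  have hpar : χ (-1) * (-1) ^ 17 = -1 := by
    have e : ((7 : ℕ) : ZMod (4 * ((2 : ℤ)).natAbs)) = -1 := by decide
    rw [← e, hχ 7]; norm_num
  obtain ⟨f, hf, ψ, hprim, hodd, hss, h1, h3, h4⟩ :=
    krizLi_characterBernoulliBlock_twist_even_sqfree (p := 67) (by norm_num) cm67 (k := 17) (by norm_num) (by norm_num)
      (fun r _ hr => EisensteinTraceForm.hasGoodReductionAtPrime_cm67 r hr)
      (fun ℓ _ hℓ => by simpa using EisensteinTraceForm.lFunction_cm67_mod ℓ hℓ) W W₁ hiso (e := 2) (by norm_num)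
      (by rw [← Int.squarefree_natAbs]; exact (Nat.Prime.prime (by norm_num : Nat.Prime 2)).squarefree) (by norm_num) hW₁ χ hχ hpar ω hω
      (q := 7) (by decide) (Nat.Prime.prime (by norm_num : Nat.Prime 7)).squarefree (by norm_num) (by decide) hd εK hεKval
      (fun θ₁ hθ₁ => KrizLi4Cert.norm_generalizedBernoulli_theta1_287296h1 ω hω θ₁ hθ₁)
      (fun θ₂ hθ₂ => KrizLi4Cert.norm_generalizedBernoulli_theta2_287296h1 ω hω θ₂ hθ₂)
  exact ⟨f, hf, ψ, ω, εK, hprim, hω, hss, h1, h3, hεK, by exact_mod_cast h4, hodd⟩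

end Summit.BirchSwinnertonDyer.BirchSwinnertonDyer.Theorems.PrintCFram.KrizLiBindersTwisted

end
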